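import Mathlib.Analysis.Calculus.MeanValue
import Mathlib.Analysis.SpecialFunctions.ExpDeriv
import Mathlib.MeasureTheory.Integral.IntervalIntegral.FundThmCalculus
import HarnessLib

/-!
# Stub `stub_uniformGronwall` of the line `SketchIdeator2` (card `separatrix-flux-pinning`)
# (crux `MarginalStabilityChain.ChainRealisation`, stmt-AnomalousDissipation-14249)

Sorry-free discharge of the registered stub `stub_uniformGronwall` (S2): the **uniform Gronwall lemma**
(R. Temam, *Infinite-Dimensional Dynamical Systems in Mechanics and Physics*, Ch. III Lemma 1.1;
C. Foias, O. Manley, R. Rosa, R. Temam, *Navier–Stokes Equations and Turbulence* (CUP 2001), Ch. II (A.61)).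

If `y' ≤ g y + h` from the right on `[t₀, ∞)` with `y, g, h ≥ 0` continuous and the sliding integrals
`∫ₜ^{t+r} g ≤ a₁`, `∫ₜ^{t+r} h ≤ a₂`, `∫ₜ^{t+r} y ≤ a₃` for all `t ≥ t₀`, then
`y (t + r) ≤ (a₃ / r + a₂) e^{a₁}` for all `t ≥ t₀`.

**Proof.**  Fix `t ≥ t₀` and put `G s = ∫ₜˢ g`, `P s = y s · e^{-G s}`.  From the right,
`P' = (y' - g y) e^{-G} ≤ h e^{-G} ≤ h` on `[t, ∞)` (`G ≥ 0` there as `g ≥ 0`; `h ≥ 0`), so the fencing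
theorem for right derivatives (`image_le_of_deriv_right_le_deriv_boundary`, applied on `[s, t + r]` to `P`
against the barrier `P s + ∫ₛ h`) gives `P (t + r) ≤ P s + ∫ₛ^{t+r} h ≤ y s + a₂` for `t ≤ s ≤ t + r`.
Since `G (t + r) ≤ a₁`, `y (t + r) e^{-a₁} - a₂ ≤ y s`; integrating over `s ∈ [t, t + r]` yields
`r (y (t + r) e^{-a₁} - a₂) ≤ a₃`, whence the claim.  Pure real analysis on top of Mathlib.
-/

set_option linter.dupNamespace false

noncomputable section

open MeasureTheory Set Filter Topology

namespace Summit.AnomalousDissipation.AnomalousDissipation.Theorems.ChainRealisation.SeparatrixFluxPinning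

/-! ## Calculus of primitives of functions continuous on a closed half-line -/

/-- A function continuous on `[t₀, ∞)` is interval integrable on every `[a, b] ⊆ [t₀, ∞)`. -/
theorem uniformGronwall_intervalIntegrable {f : ℝ → ℝ} {t₀ a b : ℝ}
    (hf : ContinuousOn f (Set.Ici t₀)) (ha : t₀ ≤ a) (hab : a ≤ b) :
    IntervalIntegrable f volume a b :=
  ContinuousOn.intervalIntegrable_of_Icc hab (hf.mono fun _ hu => ha.trans hu.1)

/-- Continuity of the primitive `x ↦ ∫ₐˣ f` on `[s, T]` for `f` continuous on `[t₀, ∞)`, `t₀ ≤ a ≤ s`. -/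
theorem uniformGronwall_continuousOn_primitive {f : ℝ → ℝ} {t₀ a s T : ℝ}
    (hf : ContinuousOn f (Set.Ici t₀)) (ha : t₀ ≤ a) (has : a ≤ s) (hsT : s ≤ T) :
    ContinuousOn (fun x => ∫ v in a..x, f v) (Set.Icc s T) := by
  have h := intervalIntegral.continuousOn_primitive_interval'
    (uniformGronwall_intervalIntegrable hf ha (has.trans hsT)) left_mem_uIcc
  rw [uIcc_of_le (has.trans hsT)] at h
  exact h.mono (Icc_subset_Icc_left has)

/-- FTC from the right: for `f` continuous on `[t₀, ∞)` and `t₀ ≤ a ≤ x`, the primitive `u ↦ ∫ₐᵘ f` has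
right derivative `f x` at `x`. -/
theorem uniformGronwall_hasDerivWithinAt_primitive {f : ℝ → ℝ} {t₀ a x : ℝ}
    (hf : ContinuousOn f (Set.Ici t₀)) (ha : t₀ ≤ a) (hax : a ≤ x) :
    HasDerivWithinAt (fun u => ∫ v in a..u, f v) (f x) (Set.Ici x) x := by
  have hx : t₀ ≤ x := ha.trans hax
  have hIoi : Set.Ioi x ⊆ Set.Ici t₀ := fun u hu => hx.trans (le_of_lt hu)
  exact intervalIntegral.integral_hasDerivWithinAt_right
    (uniformGronwall_intervalIntegrable hf ha hax)
    ((hf.mono hIoi).stronglyMeasurableAtFilter_nhdsWithin measurableSet_Ioi x)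
    ((hf x (Set.mem_Ici.mpr hx)).mono hIoi)

/-- Right derivative of the Gronwall weight `u ↦ y u · exp (-∫ₐᵘ g)` at `x ≥ a ≥ t₀`. -/
theorem uniformGronwall_hasDerivWithinAt_weighted {y y' g : ℝ → ℝ} {t₀ a x : ℝ}
    (hg : ContinuousOn g (Set.Ici t₀))
    (hyd : ∀ s : ℝ, t₀ ≤ s → HasDerivWithinAt y (y' s) (Set.Ici s) s)
    (ha : t₀ ≤ a) (hax : a ≤ x) :
    HasDerivWithinAt (fun u => y u * Real.exp (-∫ v in a..u, g v))
      (y' x * Real.exp (-∫ v in a..x, g v) + y x * (Real.exp (-∫ v in a..x, g v) * -g x))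
      (Set.Ici x) x :=
  (hyd x (ha.trans hax)).fun_mul (uniformGronwall_hasDerivWithinAt_primitive hg ha hax).fun_neg.exp

/-! ## The differential-inequality core -/

/-- The core comparison of the uniform Gronwall lemma: with `G s = ∫ₜˢ g` and `P s = y s · e^{-G s}`,
if `y' ≤ g y + h` from the right with `g, h ≥ 0` on `[t₀, ∞)`, then `P T ≤ P s + ∫ₛᵀ h` for
`t₀ ≤ t ≤ s ≤ T` (fencing theorem for right derivatives). -/
theorem uniformGronwall_weighted_le {y y' g h : ℝ → ℝ} {t₀ t s T : ℝ}
    (hyc : ContinuousOn y (Set.Ici t₀)) (hgc : ContinuousOn g (Set.Ici t₀))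
    (hhc : ContinuousOn h (Set.Ici t₀))
    (hyd : ∀ s : ℝ, t₀ ≤ s → HasDerivWithinAt y (y' s) (Set.Ici s) s)
    (hineq : ∀ s : ℝ, t₀ ≤ s → y' s ≤ g s * y s + h s)
    (hg0 : ∀ s : ℝ, t₀ ≤ s → 0 ≤ g s) (hh0 : ∀ s : ℝ, t₀ ≤ s → 0 ≤ h s)
    (ht : t₀ ≤ t) (hs : t ≤ s) (hsT : s ≤ T) :
    y T * Real.exp (-∫ u in t..T, g u) ≤
      y s * Real.exp (-∫ u in t..s, g u) + ∫ u in s..T, h u := by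
  set P : ℝ → ℝ := fun x => y x * Real.exp (-∫ u in t..x, g u)
  set P' : ℝ → ℝ := fun x =>
    y' x * Real.exp (-∫ u in t..x, g u) + y x * (Real.exp (-∫ u in t..x, g u) * -g x)
  set B : ℝ → ℝ := fun x => P s + ∫ u in s..x, h u
  have hsub : Set.Icc s T ⊆ Set.Ici t₀ := fun x hx => ht.trans (hs.trans hx.1)
  have hPc : ContinuousOn P (Set.Icc s T) :=
    (hyc.mono hsub).mul (uniformGronwall_continuousOn_primitive hgc ht hs hsT).neg.rexp
  have hPd : ∀ x ∈ Set.Ico s T, HasDerivWithinAt P (P' x) (Set.Ici x) x := fun x hx =>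
    uniformGronwall_hasDerivWithinAt_weighted hgc hyd ht (hs.trans hx.1)
  have hBc : ContinuousOn B (Set.Icc s T) :=
    continuousOn_const.add (uniformGronwall_continuousOn_primitive hhc (ht.trans hs) le_rfl hsT)
  have hBd : ∀ x ∈ Set.Ico s T, HasDerivWithinAt B (h x) (Set.Ici x) x := fun x hx =>
    (uniformGronwall_hasDerivWithinAt_primitive hhc (ht.trans hs) hx.1).const_add (P s)
  have hbound : ∀ x ∈ Set.Ico s T, P' x ≤ h x := by
    intro x hx
    have hx₀ : t₀ ≤ x := ht.trans (hs.trans hx.1)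
    have hG0 : 0 ≤ ∫ u in t..x, g u :=
      intervalIntegral.integral_nonneg (hs.trans hx.1) fun u hu => hg0 u (ht.trans hu.1)
    have hE1 : Real.exp (-∫ u in t..x, g u) ≤ 1 := Real.exp_le_one_iff.mpr (neg_nonpos.mpr hG0)
    have h1 : y' x - g x * y x ≤ h x := by linarith [hineq x hx₀]
    calc P' x = (y' x - g x * y x) * Real.exp (-∫ u in t..x, g u) := by simp only [P']; ring
      _ ≤ h x * Real.exp (-∫ u in t..x, g u) := mul_le_mul_of_nonneg_right h1 (Real.exp_pos _).le
      _ ≤ h x * 1 := mul_le_mul_of_nonneg_left hE1 (hh0 x hx₀)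
      _ = h x := mul_one _
  have hPB : P s ≤ B s := by
    show P s ≤ P s + ∫ u in s..s, h u
    rw [intervalIntegral.integral_same, add_zero]
  exact image_le_of_deriv_right_le_deriv_boundary hPc hPd hPB hBc hBd hbound (right_mem_Icc.mpr hsT)

/-! ## The stub -/

/-- Stub S2 (M, real analysis) **the uniform Gronwall lemma** (Temam, *Infinite-Dimensional Dynamical Systems*,
Ch. III Lemma 1.1; Foias–Manley–Rosa–Temam 2001 Ch. II (A.61)): if `y' ≤ g y + h` from the right on `[t₀, ∞)`
with `y, g, h ≥ 0` continuous and the sliding integrals `∫ₜ^{t+r} g ≤ a₁`, `∫ₜ^{t+r} h ≤ a₂`, `∫ₜ^{t+r} y ≤ a₃`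
for all `t ≥ t₀`, then `y(t + r) ≤ (a₃/r + a₂) e^{a₁}` for all `t ≥ t₀`. -/
theorem stub_uniformGronwall :
    ∀ (y y' g h : ℝ → ℝ) (t₀ r a₁ a₂ a₃ : ℝ), 0 < r →
      ContinuousOn y (Set.Ici t₀) → ContinuousOn g (Set.Ici t₀) → ContinuousOn h (Set.Ici t₀) →
      (∀ s : ℝ, t₀ ≤ s → HasDerivWithinAt y (y' s) (Set.Ici s) s) →
      (∀ s : ℝ, t₀ ≤ s → y' s ≤ g s * y s + h s) →
      (∀ s : ℝ, t₀ ≤ s → 0 ≤ y s) → (∀ s : ℝ, t₀ ≤ s → 0 ≤ g s) → (∀ s : ℝ, t₀ ≤ s → 0 ≤ h s) →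
      (∀ t : ℝ, t₀ ≤ t → ∫ s in t..t + r, g s ≤ a₁) →
      (∀ t : ℝ, t₀ ≤ t → ∫ s in t..t + r, h s ≤ a₂) →
      (∀ t : ℝ, t₀ ≤ t → ∫ s in t..t + r, y s ≤ a₃) →
      ∀ t : ℝ, t₀ ≤ t → y (t + r) ≤ (a₃ / r + a₂) * Real.exp a₁ := by
  intro y y' g h t₀ r a₁ a₂ a₃ hr hyc hgc hhc hyd hineq hy0 hg0 hh0 hIg hIh hIy t ht
  have htT : t ≤ t + r := le_add_of_nonneg_right hr.le
  -- pointwise lower bound for `y` on `[t, t + r]`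
  have hpt : ∀ s ∈ Set.Icc t (t + r), y (t + r) * Real.exp (-a₁) - a₂ ≤ y s := by
    intro s hs
    have hs₀ : t₀ ≤ s := ht.trans hs.1
    have key := uniformGronwall_weighted_le hyc hgc hhc hyd hineq hg0 hh0 ht hs.1 hs.2
    have hadd := intervalIntegral.integral_add_adjacent_intervals
      (uniformGronwall_intervalIntegrable hhc ht hs.1) (uniformGronwall_intervalIntegrable hhc hs₀ hs.2)
    have hnn : 0 ≤ ∫ u in t..s, h u :=
      intervalIntegral.integral_nonneg hs.1 fun u hu => hh0 u (ht.trans hu.1)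
    have hI2 : ∫ u in s..t + r, h u ≤ a₂ := by linarith [hIh t ht]
    have hG0 : 0 ≤ ∫ u in t..s, g u :=
      intervalIntegral.integral_nonneg hs.1 fun u hu => hg0 u (ht.trans hu.1)
    have hPs : y s * Real.exp (-∫ u in t..s, g u) ≤ y s :=
      mul_le_of_le_one_right (hy0 s hs₀) (Real.exp_le_one_iff.mpr (neg_nonpos.mpr hG0))
    have hPT : y (t + r) * Real.exp (-a₁) ≤ y (t + r) * Real.exp (-∫ u in t..t + r, g u) :=
      mul_le_mul_of_nonneg_left (Real.exp_le_exp.mpr (neg_le_neg (hIg t ht))) (hy0 (t + r) (ht.trans htT))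
    linarith
  -- integrate the pointwise bound over `[t, t + r]`
  have hmono := intervalIntegral.integral_mono_on (f := fun _ => y (t + r) * Real.exp (-a₁) - a₂) htT
    intervalIntegrable_const (uniformGronwall_intervalIntegrable hyc ht htT) hpt
  rw [intervalIntegral.integral_const, smul_eq_mul, add_sub_cancel_left] at hmono
  have h4 : y (t + r) * Real.exp (-a₁) - a₂ ≤ a₃ / r := by
    rw [le_div_iff₀ hr]; linarith [hIy t ht]
  have h6 : y (t + r) = y (t + r) * Real.exp (-a₁) * Real.exp a₁ := by
    rw [mul_assoc, ← Real.exp_add, neg_add_cancel, Real.exp_zero, mul_one]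
  rw [h6]
  exact mul_le_mul_of_nonneg_right (by linarith) (Real.exp_pos a₁).le

end Summit.AnomalousDissipation.AnomalousDissipation.Theorems.ChainRealisation.SeparatrixFluxPinning

end
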